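import Mathlib
import Summits.ValiantsHypothesis.ValiantsHypothesis.Theorems.BarrierLeverDefinableEquationsDefs
import Summits.ValiantsHypothesis.ValiantsHypothesis.Theorems.BarrierLeverDefinableEquationsStubRazTopUniversality

/-!
# Crux `BarrierLever.DefinableEquations` (stmt-ValiantsHypothesis-8745), line `registered` —
# a degree lower bound for equations of the Raz variety

Every nonzero polynomial `P` in the top coefficient variables that vanishes on the image of Raz's
map `Γ` (the Raz points `razPoint n b y`, all labellings `y`) has total degree `> t` whenever
`t (2n + 2) ≤ n ^ b` — in particular `> n^(b-1) / 4` for `n ≥ 2`.  Reason: a `t`-sparse form of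
degree `n` has fan-in-two size `≤ t (2n + 2) ≤ n ^ b`, so (Raz top universality, landed stub A
`stub_razTopUniversality`) every point of `ℂ^{topMonomials n}` supported on `≤ t` coordinates is a
Raz point; a polynomial vanishing on all coordinate `t`-planes has only monomials involving `> t`
distinct variables (kill the variables outside the support of a putative short monomial and apply
`MvPolynomial.funext`).

Consequence for the open stub H_poly (`stub_polyShortTableauEquation`): any witness `(τ, a)` at
`(b, n)` uses a datum of degree `D > n^(b-1)/4` — low-degree (in particular flattening / bounded-order
catalecticant) data cannot work, uniformly in the shortness scale.
-/

-- Sub = Summit single-conjunct layout: the duplicated namespace component is mandated by the tree.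
set_option linter.dupNamespace false

noncomputable section

namespace Summit.ValiantsHypothesis.ValiantsHypothesis.Theorems.BarrierLeverDefinableEquations

open MvPolynomial
open Literature.Computability.AlgebraicComplexity Literature.Barriers.ValiantsHypothesis
open scoped BigOperators

namespace DegreeLowerBound

/-- A pure power `X i ^ k` costs at most `k` gates. [folklore] -/
theorem complexity_X_pow_le {σ : Type*} (i : σ) (k : ℕ) :
    complexity ((X i : MvPolynomial σ ℂ) ^ k) ≤ k := by
  have h := complexity_finset_prod_le (Finset.range k) (fun _ => (X i : MvPolynomial σ ℂ))
  have hX : complexity (X i : MvPolynomial σ ℂ) = 0 := complexity_X_holds i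
  rw [Finset.prod_const, Finset.card_range, Finset.sum_const, Finset.card_range, smul_eq_mul, hX,
    mul_zero, zero_add] at h
  exact h

/-- A monomial `a • x^m` in `n` variables costs at most `deg m + n + 1` gates. [folklore] -/
theorem complexity_monomial_le {n : ℕ} (m : Fin n →₀ ℕ) (a : ℂ) :
    complexity (monomial m a : MvPolynomial (Fin n) ℂ) ≤ m.degree + n + 1 := by
  rw [MvPolynomial.monomial_eq]
  have hprod : complexity (m.prod fun i e => (X i : MvPolynomial (Fin n) ℂ) ^ e) ≤ m.degree + n := by
    unfold Finsupp.prod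
    refine (complexity_finset_prod_le m.support (fun i => (X i : MvPolynomial (Fin n) ℂ) ^ m i)).trans ?_
    rw [Finsupp.degree_apply]
    have h1 : ∑ i ∈ m.support, complexity ((X i : MvPolynomial (Fin n) ℂ) ^ m i) ≤
        ∑ i ∈ m.support, m i := Finset.sum_le_sum fun i _ => complexity_X_pow_le i (m i)
    have h2 : m.support.card ≤ n := by
      simpa using Finset.card_le_univ m.support
    omega
  calc complexity (C a * m.prod fun i e => (X i : MvPolynomial (Fin n) ℂ) ^ e)
      ≤ complexity (C a : MvPolynomial (Fin n) ℂ) +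
          complexity (m.prod fun i e => (X i : MvPolynomial (Fin n) ℂ) ^ e) + 1 :=
        complexity_mul_le_holds _ _
    _ ≤ 0 + (m.degree + n) + 1 := by
        gcongr
        exact (complexity_C_holds (σ := Fin n) a).le
    _ = m.degree + n + 1 := by ring

/-- Size of the sparse form `∑_{e ∈ S} v_e x^e`: `≤ #S · (2n + 2)`. [folklore] -/
theorem complexity_sparseForm_le {n : ℕ} (S : Finset (topMonomials n)) (v : topMonomials n → ℂ) :
    complexity (∑ e ∈ S, monomial (e : Fin n →₀ ℕ) (v e) : MvPolynomial (Fin n) ℂ) ≤ S.card * (2 * n + 2) := by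
  refine (complexity_finset_sum_le S _).trans ?_
  have h : ∑ e ∈ S, complexity (monomial (e : Fin n →₀ ℕ) (v e) : MvPolynomial (Fin n) ℂ) ≤
      ∑ e ∈ S, (2 * n + 1) := by
    refine Finset.sum_le_sum fun e _ => ?_
    have he : (e : Fin n →₀ ℕ).degree = n := e.2
    have := complexity_monomial_le (e : Fin n →₀ ℕ) (v e)
    omega
  rw [Finset.sum_const, smul_eq_mul] at h
  calc ∑ e ∈ S, complexity (monomial (e : Fin n →₀ ℕ) (v e) : MvPolynomial (Fin n) ℂ) + S.card
      ≤ S.card * (2 * n + 1) + S.card := by omega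
    _ = S.card * (2 * n + 2) := by ring

/-- Degree of a sparse form of top monomials: `≤ n`. [folklore] -/
theorem totalDegree_sparseForm_le {n : ℕ} (S : Finset (topMonomials n)) (v : topMonomials n → ℂ) :
    (∑ e ∈ S, monomial (e : Fin n →₀ ℕ) (v e) : MvPolynomial (Fin n) ℂ).totalDegree ≤ n := by
  refine MvPolynomial.totalDegree_finsetSum_le fun e _ => ?_
  refine (MvPolynomial.totalDegree_monomial_le _ _).trans (le_of_eq ?_)
  have he : (e : Fin n →₀ ℕ).degree = n := e.2
  rw [Finsupp.degree_apply] at he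
  exact he

/-- Coefficients of a sparse form on top monomials. [folklore] -/
theorem coeff_sparseForm {n : ℕ} (S : Finset (topMonomials n)) (v : topMonomials n → ℂ)
    (e : topMonomials n) :
    coeff (e : Fin n →₀ ℕ) (∑ e' ∈ S, monomial (e' : Fin n →₀ ℕ) (v e') : MvPolynomial (Fin n) ℂ) =
      if e ∈ S then v e else 0 := by
  classical
  rw [MvPolynomial.coeff_sum]
  simp only [MvPolynomial.coeff_monomial]
  by_cases he : e ∈ S
  · rw [if_pos he, Finset.sum_eq_single_of_mem e he]
    · rw [if_pos rfl]
    · intro x _ hxe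
      rw [if_neg]
      exact fun hx => hxe (Subtype.ext hx)
  · rw [if_neg he]
    refine Finset.sum_eq_zero fun x hx => ?_
    rw [if_neg]
    intro hxe
    exact he ((Subtype.ext hxe : x = e) ▸ hx)

/-- **Every point supported on `≤ t` coordinates is a Raz point** when `t (2n + 2) ≤ n ^ b`,
`n ≥ 1` (sparse forms are small circuits + Raz top universality). [folklore] -/
theorem exists_razPoint_eq_of_sparse {n b t : ℕ} (hn : 1 ≤ n) (ht : t * (2 * n + 2) ≤ n ^ b)
    (S : Finset (topMonomials n)) (hS : S.card ≤ t) (v : topMonomials n → ℂ)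
    (hv : ∀ e, e ∉ S → v e = 0) :
    ∃ y : RazUniversal.Lab (Fin n) n (razSlots n b) → ℂ, razPoint n b y = v := by
  have hmem : (∑ e ∈ S, monomial (e : Fin n →₀ ℕ) (v e) : MvPolynomial (Fin n) ℂ) ∈ SmallCircuits ℂ n b := by
    refine ⟨totalDegree_sparseForm_le S v, (complexity_sparseForm_le S v).trans ?_⟩
    exact (Nat.mul_le_mul_right _ hS).trans ht
  obtain ⟨y, hy⟩ := stub_razTopUniversality n b hn _ hmem
  refine ⟨y, funext fun e => ?_⟩
  rw [hy e, coeff_sparseForm]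
  by_cases he : e ∈ S
  · rw [if_pos he]
  · rw [if_neg he, hv e he]

/-- **Monomials of a polynomial vanishing on all coordinate `t`-planes involve `> t` variables.**
Over `ℂ`, if `eval v P = 0` for every `v` supported on a set of `≤ t` coordinates, then every
exponent in the support of `P` has more than `t` nonzero entries (kill the other variables with
`bind₁` and apply `MvPolynomial.funext`). [folklore] -/
theorem lt_card_support_of_eval_eq_zero {σ : Type*} {P : MvPolynomial σ ℂ} {t : ℕ}
    (h : ∀ S : Finset σ, S.card ≤ t → ∀ v : σ → ℂ, (∀ i, i ∉ S → v i = 0) → eval v P = 0)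
    {d : σ →₀ ℕ} (hd : d ∈ P.support) : t < d.support.card := by
  classical
  by_contra hle
  push Not at hle
  set S := d.support with hSdef
  -- kill the variables outside `S`
  let g : σ → MvPolynomial σ ℂ := fun i => if i ∈ S then X i else 0
  set Q := bind₁ g P with hQdef
  -- `Q` vanishes identically
  have hQ0 : Q = 0 := by
    refine MvPolynomial.funext fun w => ?_
    rw [map_zero, hQdef]
    show eval₂Hom (RingHom.id ℂ) w (bind₁ g P) = 0
    rw [eval₂Hom_bind₁]
    exact h S hle (fun i => eval w (g i)) fun i hi => by simp [g, hi]
  -- but its `d`-coefficient is that of `P`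
  have hmono : ∀ m : σ →₀ ℕ, bind₁ g (monomial m (coeff m P)) =
      if m.support ⊆ S then monomial m (coeff m P) else 0 := by
    intro m
    rw [bind₁_monomial]
    split_ifs with hm
    · have : ∏ i ∈ m.support, g i ^ m i = ∏ i ∈ m.support, (X i : MvPolynomial σ ℂ) ^ m i := by
        refine Finset.prod_congr rfl fun i hi => ?_
        simp [g, hm hi]
      rw [this, MvPolynomial.prod_X_pow_eq_monomial, C_mul_monomial, mul_one]
    · rw [Finset.not_subset] at hm
      obtain ⟨i, hi, hiS⟩ := hm
      have hz : g i ^ m i = 0 := by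
        have hmi : m i ≠ 0 := Finsupp.mem_support_iff.mp hi
        simp [g, hiS, hmi]
      rw [Finset.prod_eq_zero hi hz, mul_zero]
  have hQd : coeff d Q = coeff d P := by
    rw [hQdef]
    conv_lhs => rw [P.as_sum, map_sum]
    rw [coeff_sum]
    simp_rw [hmono]
    rw [Finset.sum_eq_single d]
    · rw [if_pos (subset_refl _), coeff_monomial, if_pos rfl]
    · intro m _ hmd
      split_ifs
      · rw [coeff_monomial, if_neg hmd]
      · rw [coeff_zero]
    · intro hd'
      exact absurd hd hd'
  rw [hQ0, coeff_zero] at hQd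
  exact (MvPolynomial.mem_support_iff.mp hd) hQd.symm

end DegreeLowerBound

open DegreeLowerBound

/-- **Degree lower bound for equations of the Raz variety.**  If `n ≥ 1`, `t (2n + 2) ≤ n ^ b`, and
`P ≠ 0` vanishes at every Raz point `razPoint n b y`, then every monomial of `P` involves more than
`t` distinct top coefficient variables; in particular `t < P.totalDegree`.  (So a witness of the
open stub H_poly at `(b, n)` has a datum of degree `D > t`, e.g. `D > n^(b-1)/4` for `n ≥ 2`.)
[folklore] -/
theorem lt_totalDegree_of_eval_razPoint_eq_zero :
    ∀ n b t : ℕ, 1 ≤ n → t * (2 * n + 2) ≤ n ^ b → ∀ P : MvPolynomial (topMonomials n) ℂ, P ≠ 0 →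
      (∀ y : RazUniversal.Lab (Fin n) n (razSlots n b) → ℂ, eval (razPoint n b y) P = 0) →
        t < P.totalDegree := by
  intro n b t hn ht P hP hvan
  classical
  obtain ⟨d, hd⟩ : ∃ d, d ∈ P.support := by
    by_contra hno
    push Not at hno
    exact hP (MvPolynomial.support_eq_empty.mp (Finset.eq_empty_of_forall_notMem hno))
  have hplanes : ∀ S : Finset (topMonomials n), S.card ≤ t → ∀ v : topMonomials n → ℂ,
      (∀ i, i ∉ S → v i = 0) → eval v P = 0 := by
    intro S hS v hv
    obtain ⟨y, hy⟩ := exists_razPoint_eq_of_sparse hn ht S hS v hv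
    rw [← hy]
    exact hvan y
  have hcard := lt_card_support_of_eval_eq_zero hplanes hd
  refine lt_of_lt_of_le hcard ?_
  refine le_trans ?_ (MvPolynomial.le_totalDegree hd)
  -- `#support d ≤ ∑ i ∈ support, d i`
  calc d.support.card = ∑ i ∈ d.support, 1 := by simp
    _ ≤ d.sum fun _ e => e := by
        unfold Finsupp.sum
        exact Finset.sum_le_sum fun i hi => Nat.one_le_iff_ne_zero.mpr (Finsupp.mem_support_iff.mp hi)

/-- The same bound for every monomial: each exponent of `P` has more than `t` nonzero entries.
[folklore] -/
theorem lt_card_support_of_eval_razPoint_eq_zero {n b t : ℕ} (hn : 1 ≤ n)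
    (ht : t * (2 * n + 2) ≤ n ^ b) {P : MvPolynomial (topMonomials n) ℂ}
    (hvan : ∀ y : RazUniversal.Lab (Fin n) n (razSlots n b) → ℂ, eval (razPoint n b y) P = 0)
    {d : topMonomials n →₀ ℕ} (hd : d ∈ P.support) : t < d.support.card := by
  classical
  refine lt_card_support_of_eval_eq_zero (fun S hS v hv => ?_) hd
  obtain ⟨y, hy⟩ := exists_razPoint_eq_of_sparse hn ht S hS v hv
  rw [← hy]
  exact hvan y

/-! ## Consequence for the registered stub H_poly: witnesses use a datum of large degree

(appended by the lead c2, cycle 2) A tableau contraction `F_τ` is a polynomial of degree `≤ τ.D` in the top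
coefficients, so a short combination `combPoly τ a` has degree `≤ max_i (τ i).D`; with the degree lower bound,
every witness `(τ, a)` of the polynomially-short tableau equation at `(b, n)` has SOME datum with
`(τ i).D > t` whenever `t (2n + 2) ≤ n ^ b`. -/

namespace DegreeLowerBound

/-- The tableau-contraction polynomial of a datum has total degree at most its number of blocks `D`.
[folklore] -/
theorem totalDegree_poly_le {n : ℕ} (τ : TabDatum n) : τ.poly.totalDegree ≤ τ.D := by
  classical
  unfold TabDatum.poly
  refine MvPolynomial.totalDegree_finsetSum_le fun i _ => ?_
  refine (MvPolynomial.totalDegree_smul_le _ _).trans ?_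
  refine (MvPolynomial.totalDegree_finsetProd _ _).trans ?_
  calc ∑ k : Fin τ.D, ((symWeight (expOf fun l => i (k, l)) : ℂ) •
          X (expTop fun l => i (k, l)) : MvPolynomial (topMonomials n) ℂ).totalDegree
      ≤ ∑ _k : Fin τ.D, 1 := Finset.sum_le_sum fun k _ =>
          (MvPolynomial.totalDegree_smul_le _ _).trans (MvPolynomial.totalDegree_X _).le
    _ = τ.D := by simp

/-- A combination of tableau contractions has total degree at most the largest block count.
[folklore] -/
theorem totalDegree_combPoly_le {n k : ℕ} (τ : Fin k → TabDatum n) (a : Fin k → ℂ) :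
    (combPoly τ a).totalDegree ≤ Finset.univ.sup fun i => (τ i).D := by
  classical
  unfold combPoly
  refine MvPolynomial.totalDegree_finsetSum_le fun i hi => ?_
  exact ((MvPolynomial.totalDegree_smul_le _ _).trans (totalDegree_poly_le (τ i))).trans
    (Finset.le_sup (f := fun i => (τ i).D) hi)

end DegreeLowerBound

/-- **Witnesses of H_poly have a datum of degree `> t`.**  If `n ≥ 1`, `t (2n + 2) ≤ n ^ b`, and the
combination `combPoly τ a` is nonzero and vanishes at every Raz point `razPoint n b y`, then some datum
`τ i` has `t < (τ i).D` (registered sub-goal; degree lower bound + `deg F_τ ≤ τ.D`). [folklore] -/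
theorem exists_datum_degree_gt :
    ∀ n b t : ℕ, 1 ≤ n → t * (2 * n + 2) ≤ n ^ b → ∀ (k : ℕ) (τ : Fin k → TabDatum n) (a : Fin k → ℂ),
      combPoly τ a ≠ 0 →
        (∀ y : RazUniversal.Lab (Fin n) n (razSlots n b) → ℂ, eval (razPoint n b y) (combPoly τ a) = 0) →
          ∃ i : Fin k, t < (τ i).D := by
  intro n b t hn ht k τ a hne hvan
  classical
  have hlt : t < (combPoly τ a).totalDegree :=
    lt_totalDegree_of_eval_razPoint_eq_zero n b t hn ht _ hne hvan
  have hsup : t < Finset.univ.sup fun i => (τ i).D :=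
    lt_of_lt_of_le hlt (DegreeLowerBound.totalDegree_combPoly_le τ a)
  obtain ⟨i, -, hi⟩ := Finset.lt_sup_iff.mp hsup
  exact ⟨i, hi⟩

end Summit.ValiantsHypothesis.ValiantsHypothesis.Theorems.BarrierLeverDefinableEquations

end
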